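import Summits.BirchSwinnertonDyer.BirchSwinnertonDyer.Theorems.CountingDoorF2AtThreeRootNumberClosedForm
import Summits.BirchSwinnertonDyer.Rank2.F2DensityAlgebra
import Literature.NumberTheory.EllipticCurves.RootNumberSmulProofs
import Mathlib.Tactic.NormNum.LegendreSymbol
import Mathlib.Tactic.NormNum.Prime
import HarnessLib

/-!
# BirchSwinnertonDyer / CountingDoorF2AtThree — crux I2 `RootNumberPlusLowerDensityLargeF2`
# (stmt-BirchSwinnertonDyer-19441): TIGHTNESS — both hypotheses of I2 are load-bearing; two certified
# members of each root number; infinitely many members of `F₂` of each root number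

Route `route-BirchSwinnertonDyer-CountingDoorF2AtThree` (cell bsd-rank2), seat bsd-rank2-rootno-p2 GEN 5
(WIDTH-LEVER lane B «closed-form local root numbers»). The crux I2 reads

  `∀ Φ : CongruenceFamily₂, Φ.IsLarge → (∀ p prime, (Φ.residues p).Nonempty) →
      ∃ ρ > 1/6, Φ.DensityOnGE (fun a ↦ a.curve.rootNumber = 1) ρ`.

This file records, as theorems, what any proof of I2 must use (the `_false_without_<H>` tests of the
crux protocol) and the first EXISTENCE statements about root numbers in `F₂` in the tree:

* §1 Two certified members, one of each sign, from lane B's closed form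
  `F2RootNumber.rootNumber_curve_eq_neg_moebius_mul_jacobiSym_of_odd` (`w(E_a) = −μ(|Δ|)·J(−c₆ | |Δ|)`
  for square-free odd `Δ(a)`, modulo Modularity `exists_isNewformOf`): `a⁻ = (0, 0, 1, 1)`, i.e.
  `y² + y = x(x − 1)(x + 1) = x³ − x` — Cremona 37a1, `Δ = 37`, `c₆ = −216`, `μ(37) = −1`,
  `J(216 | 37) = −1`, so `w = −1` (`rootNumber_curve_p37`); and `a⁺ = (2, 0, 0, 1)`, i.e.
  `y² + 2xy + y = x³` — conductor 19, `Δ = −19`, `c₆ = 8`, `μ(19) = −1`, `J(−8 | 19) = 1`, so `w = +1`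
  (`rootNumber_curve_p19`).
* §2 `…_false_without_nonempty` (UNCONDITIONAL): the hypothesis «nonempty residue set at every prime»
  cannot be dropped — the family with NO condition except the EMPTY condition at `2` is large (large at
  every `p ≥ 3`) and has no member, so no property has lower density `> 0` in it
  (`not_densityOnGE_of_forall_mem_not`, `exists_isLarge_forall_not_mem`).
* §3 `…_false_without_isLarge` (modulo Modularity): the hypothesis `IsLarge` cannot be dropped — the
  POINT family of `a⁻` (condition `a ≡ a⁻ (mod p)` at EVERY prime) has nonempty residue sets and the
  single member `a⁻` (an integer divisible by every prime is `0`), of root number `−1`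
  (`exists_pointFamily`). Largeness is exactly what excludes such profinitely thin families: every proof
  of I2 must use `IsLarge` beyond the nonemptiness of the height balls.
* §4 Weighted SCALINGS `t • a = (t a₁, t² a₂, t² a₂', t³ a₃)` (`t ≠ 0`): `(t • a).curve` is the
  variable change `u = t⁻¹` of `a.curve` (`curve_scale_eq_smul`), so membership and the root number are
  preserved (`isMember_scale`, `rootNumber_curve_scale`, by the tree's PROVED isomorphism invariance
  `rootNumber_smul_holds`), while the parameters are pairwise distinct; hence (modulo Modularity, for the
  sign certificates only) `F₂` has INFINITELY MANY members of root number `−1` and infinitely many of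
  root number `+1` (`infinite_isMember_rootNumber_eq_neg_one`, `…_eq_one`). HONEST SCOPE: the members
  `t • a⁻` are all `ℚ`-isomorphic to 37a1 (`F₂` counts integer models with two marked points, and
  densities along the height count exactly these); nothing here is a density statement, and the
  scalings of one member have density `0` in every large family (lane-B census R4′).

Nothing here proves or refutes I2 (OPEN: a `2/3`-bias weak-Chowla bound for `λ(Δ_{F₂})·χ`, lane-B
census v4 / crux ideation census r1); nothing reads an analytic rank (B1); no S0 motion; BSD is not
proved by any of this. THEOREMS ONLY (no definition, no named fact beyond the explicit hypothesis
`exists_isNewformOf`, no `sorry`); standard axioms. PARTITION: none — r_an ≥ 2, summit axis S0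
(D-0036(1) funded rung); TWIN (D-0056): n/a.

References: J. E. Cremona, *Algorithms for Modular Elliptic Curves* (1997), Table 1 (curves 19a, 37a:
signs of the functional equation) [Cremona1997]; D. Rohrlich, Compositio Math. 87 (1993) Prop. 2(ii)
[Rohrlich1993Compositio]; H. A. Helfgott, arXiv:math/0408141 §1 [Helfgott2004RootNumber]; M. Bhargava,
W. Ho, arXiv:2207.03309 §1 (the family `F₂`, large subfamilies) [BhargavaHo2022]; J. H. Silverman,
*AEC* (2009) App. C §16 (isomorphism invariance of the `L`-function) [SilvermanAEC2009].
-/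

set_option linter.dupNamespace false

noncomputable section

open scoped Classical NumberTheorySymbols

open Filter Topology Finset WeierstrassCurve
  Literature.NumberTheory.EllipticCurves
  Literature.NumberTheory.EllipticCurves.BhargavaHo2022
  Summit.BirchSwinnertonDyer.Rank2

namespace Summit.BirchSwinnertonDyer.BirchSwinnertonDyer.Theorems.F2RootNumber

/-! ### §1 Two certified members: `(0,0,1,1)` (37a1, `w = −1`) and `(2,0,0,1)` (19a, `w = +1`) -/

/-- The member `(0, 0, 1, 1)` is `y² + y = x³ − x` (`[0, 0, 1, −1, 0]`, Cremona 37a1).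
[cite: BhargavaHo2022, §1 (definition of F₂)] -/
theorem curveInt_p37 : (⟨0, 0, 1, 1⟩ : Params).curveInt = ⟨0, 0, 1, -1, 0⟩ := by
  simp [Params.curveInt]

/-- `Δ(0, 0, 1, 1) = 37`. [cite: BhargavaHo2022, §1 (discriminant polynomial of F₂)] -/
theorem Δ_p37 : (⟨0, 0, 1, 1⟩ : Params).curveInt.Δ = 37 := by
  rw [curveInt_p37]
  norm_num [WeierstrassCurve.Δ, WeierstrassCurve.b₂, WeierstrassCurve.b₄, WeierstrassCurve.b₆,
    WeierstrassCurve.b₈]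

/-- `c₆(0, 0, 1, 1) = −216`. [cite: BhargavaHo2022, §1 (definition of F₂)] -/
theorem c₆_p37 : (⟨0, 0, 1, 1⟩ : Params).curveInt.c₆ = -216 := by
  rw [curveInt_p37]
  norm_num [WeierstrassCurve.c₆, WeierstrassCurve.b₂, WeierstrassCurve.b₄, WeierstrassCurve.b₆]

/-- `(0, 0, 1, 1)` is a member of `F₂` (`Δ = 37 ≠ 0`). [cite: BhargavaHo2022, §1 (definition of F₂)] -/
theorem isMember_p37 : (⟨0, 0, 1, 1⟩ : Params).IsMember := by
  rw [Params.IsMember, Δ_p37]; norm_num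

/-- **`w(37a1) = −1` in `F₂`-coordinates** (modulo Modularity): the member `(0, 0, 1, 1)`,
`y² + y = x³ − x`, has square-free odd `Δ = 37`, `μ(37) = −1`, `J(−c₆ | 37) = J(216 | 37) = −1`, so
`w = −μ·J = −1` by the closed form `rootNumber_curve_eq_neg_moebius_mul_jacobiSym_of_odd`.
[cite: Cremona1997, Table 1 (curve 37a1: sign of the functional equation −1)]
[cite: Rohrlich1993Compositio, Prop. 2(ii)] -/
theorem rootNumber_curve_p37 (hmod : ModularForms.exists_isNewformOf) :
    (⟨0, 0, 1, 1⟩ : Params).curve.rootNumber = -1 := by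
  have hsq : Squarefree (⟨0, 0, 1, 1⟩ : Params).curveInt.Δ := by
    rw [Δ_p37, ← Int.squarefree_natAbs]
    exact Irreducible.squarefree (show Nat.Prime 37 by norm_num)
  have hodd : ¬ (2 : ℤ) ∣ (⟨0, 0, 1, 1⟩ : Params).curveInt.Δ := by rw [Δ_p37]; norm_num
  rw [rootNumber_curve_eq_neg_moebius_mul_jacobiSym_of_odd _ hsq hodd hmod, Δ_p37, c₆_p37]
  have hμ : ArithmeticFunction.moebius 37 = -1 :=
    ArithmeticFunction.moebius_apply_prime (by norm_num)
  have hJ : J(216 | 37) = -1 := by norm_num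
  rw [show Int.natAbs 37 = 37 from rfl, hμ, show -(-216 : ℤ) = 216 by norm_num, hJ]
  norm_num

/-- The member `(2, 0, 0, 1)` is `y² + 2xy + y = x³` (`[2, 0, 1, 0, 0]`, conductor `19`).
[cite: BhargavaHo2022, §1 (definition of F₂)] -/
theorem curveInt_p19 : (⟨2, 0, 0, 1⟩ : Params).curveInt = ⟨2, 0, 1, 0, 0⟩ := by
  simp [Params.curveInt]

/-- `Δ(2, 0, 0, 1) = −19`. [cite: BhargavaHo2022, §1 (discriminant polynomial of F₂)] -/
theorem Δ_p19 : (⟨2, 0, 0, 1⟩ : Params).curveInt.Δ = -19 := by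
  rw [curveInt_p19]
  norm_num [WeierstrassCurve.Δ, WeierstrassCurve.b₂, WeierstrassCurve.b₄, WeierstrassCurve.b₆,
    WeierstrassCurve.b₈]

/-- `c₆(2, 0, 0, 1) = 8`. [cite: BhargavaHo2022, §1 (definition of F₂)] -/
theorem c₆_p19 : (⟨2, 0, 0, 1⟩ : Params).curveInt.c₆ = 8 := by
  rw [curveInt_p19]
  norm_num [WeierstrassCurve.c₆, WeierstrassCurve.b₂, WeierstrassCurve.b₄, WeierstrassCurve.b₆]

/-- `(2, 0, 0, 1)` is a member of `F₂` (`Δ = −19 ≠ 0`). [cite: BhargavaHo2022, §1 (definition of F₂)] -/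
theorem isMember_p19 : (⟨2, 0, 0, 1⟩ : Params).IsMember := by
  rw [Params.IsMember, Δ_p19]; norm_num

/-- **`w = +1` for the member `(2, 0, 0, 1)`** (conductor `19`; modulo Modularity): square-free odd
`Δ = −19`, `μ(19) = −1`, `J(−c₆ | 19) = J(−8 | 19) = 1`, so `w = −μ·J = +1`.
[cite: Cremona1997, Table 1 (curve 19a: sign of the functional equation +1)]
[cite: Rohrlich1993Compositio, Prop. 2(ii)] -/
theorem rootNumber_curve_p19 (hmod : ModularForms.exists_isNewformOf) :
    (⟨2, 0, 0, 1⟩ : Params).curve.rootNumber = 1 := by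
  have hsq : Squarefree (⟨2, 0, 0, 1⟩ : Params).curveInt.Δ := by
    rw [Δ_p19, ← Int.squarefree_natAbs]
    exact Irreducible.squarefree (show Nat.Prime 19 by norm_num)
  have hodd : ¬ (2 : ℤ) ∣ (⟨2, 0, 0, 1⟩ : Params).curveInt.Δ := by rw [Δ_p19]; norm_num
  rw [rootNumber_curve_eq_neg_moebius_mul_jacobiSym_of_odd _ hsq hodd hmod, Δ_p19, c₆_p19]
  have hμ : ArithmeticFunction.moebius 19 = -1 :=
    ArithmeticFunction.moebius_apply_prime (by norm_num)
  have hJ : J(-8 | 19) = 1 := by norm_num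
  rw [show Int.natAbs (-19) = 19 from rfl, hμ, hJ]
  norm_num

/-! ### §2 The nonempty-residue hypothesis is load-bearing (unconditional) -/

/-- If NO member of `Φ` satisfies `P`, then `P` has no positive lower density in `Φ` (every proportion
is `0`, an empty ball included). [folklore] -/
theorem not_densityOnGE_of_forall_mem_not (Φ : CongruenceFamily₂) {P : Params → Prop}
    (h : ∀ a, Φ.Mem a → ¬ P a) {ρ : ℝ} (hρ : 0 < ρ) : ¬ Φ.DensityOnGE P ρ := by
  intro hD
  have hprop : ∀ X, Φ.proportionOn P X = 0 := by
    intro X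
    rw [proportionOn_eq_card_filter_div Φ P X]
    have h0 : (Φ.below X).filter P = ∅ := by
      refine Finset.filter_false_of_mem fun a ha ↦ h a ((Φ.mem_below_iff a X).1 ha).1
    rw [h0, Finset.card_empty, Nat.cast_zero, zero_div]
  obtain ⟨X, hX⟩ := (hD (ρ / 2) (by linarith)).exists
  rw [hprop X] at hX
  linarith

/-- **A large family with an empty residue set and no member**: no condition at any prime except the
EMPTY condition at `2` (`expt = 0`, `residues 2 = ∅`, `residues p = univ` otherwise) — large (at every
`p ≥ 3` no member is excluded), and no `a` is a member. [cite: BhargavaHo2022, §1 (definition of "large": all but finitely many primes)] -/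
theorem exists_isLarge_forall_not_mem :
    ∃ Φ : CongruenceFamily₂, Φ.IsLarge ∧ Φ.residues 2 = ∅ ∧ ∀ a, ¬ Φ.Mem a := by
  refine ⟨⟨fun _ ↦ 0, fun p ↦ if p = 2 then ∅ else Set.univ⟩, ⟨3, fun p hp _ a _ _ ↦ ?_⟩,
    by simp, fun a ha ↦ ?_⟩
  · have hp2 : p ≠ 2 := by omega
    show _ ∈ (if p = 2 then (∅ : Set _) else Set.univ)
    rw [if_neg hp2]
    exact Set.mem_univ _
  · have h2 := ha.2 2 Nat.prime_two
    show False
    have h2' : _ ∈ (if (2 : ℕ) = 2 then (∅ : Set _) else Set.univ) := h2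
    rw [if_pos rfl] at h2'
    exact h2'

/-- **I2 is false without the nonempty-residue hypothesis** (UNCONDITIONAL): it is NOT true that every
large `Φ ⊆ F₂` has root number `+1` with lower density `> 1/6` — the large family of
`exists_isLarge_forall_not_mem` has no member. So the hypothesis «`(Φ.residues p).Nonempty` at every
prime» of `RootNumberPlusLowerDensityLargeF2` is load-bearing. [cite: BhargavaHo2022, §1 (large subfamilies)] -/
theorem rootNumberPlusLowerDensity_false_without_nonempty :
    ¬ ∀ Φ : CongruenceFamily₂, Φ.IsLarge →
        ∃ ρ : ℝ, 1 / 6 < ρ ∧ Φ.DensityOnGE (fun a ↦ a.curve.rootNumber = 1) ρ := by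
  intro h
  obtain ⟨Φ, hL, -, hno⟩ := exists_isLarge_forall_not_mem
  obtain ⟨ρ, hρ, hD⟩ := h Φ hL
  exact not_densityOnGE_of_forall_mem_not Φ (fun a ha _ ↦ hno a ha) (by linarith) hD

/-! ### §3 The largeness hypothesis is load-bearing (modulo Modularity) -/

/-- An integer congruent to `b` modulo every prime equals `b` (an integer divisible by every prime is
`0`). [folklore] -/
theorem eq_of_forall_prime_dvd_sub {x b : ℤ} (h : ∀ p : ℕ, p.Prime → (p : ℤ) ∣ x - b) : x = b := by
  obtain ⟨p, hlt, hp⟩ := Nat.exists_infinite_primes ((x - b).natAbs + 1)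
  have h0 : x - b = 0 :=
    Int.eq_zero_of_dvd_of_natAbs_lt_natAbs (h p hp) (by rw [Int.natAbs_natCast]; omega)
  omega

/-- Equal residues modulo `p ^ 1` give divisibility of the difference by `p`. [folklore] -/
theorem dvd_sub_of_intCast_zmod_pow_one_eq {x b : ℤ} {p : ℕ}
    (h : (x : ZMod (p ^ 1)) = (b : ZMod (p ^ 1))) : (p : ℤ) ∣ b - x := by
  have h' := (ZMod.intCast_eq_intCast_iff_dvd_sub x b (p ^ 1)).mp h
  simpa using h'

/-- **The point family of a member `a⁰`**: the condition `a ≡ a⁰ (mod p)` at EVERY prime `p` defines a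
subfamily of `F₂` with nonempty residue sets whose only member is `a⁰` (an integer divisible by every
prime is `0`). It is not large (at a prime `p` with `p² ∤ Δ(b)` for some member `b ≢ a⁰ (mod p)` it
excludes `b`) — the profinitely thin families that `IsLarge` rules out.
[cite: BhargavaHo2022, §1 (subfamilies defined by congruence conditions)] -/
theorem exists_pointFamily (a₀ : Params) (h₀ : a₀.IsMember) :
    ∃ Ψ : CongruenceFamily₂, (∀ p : ℕ, p.Prime → (Ψ.residues p).Nonempty) ∧
      ∀ a, Ψ.Mem a ↔ a = a₀ := by
  let Ψ : CongruenceFamily₂ := ⟨fun _ ↦ 1, fun p ↦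
    {((a₀.a₁ : ZMod (p ^ 1)), (a₀.a₂ : ZMod (p ^ 1)), (a₀.a₂' : ZMod (p ^ 1)),
      (a₀.a₃ : ZMod (p ^ 1)))}⟩
  refine ⟨Ψ, fun p _ ↦ Set.singleton_nonempty _, fun a ↦ ⟨fun ha ↦ ?_, fun ha ↦ ?_⟩⟩
  · have key : ∀ p : ℕ, p.Prime → (a.a₁ : ZMod (p ^ 1)) = (a₀.a₁ : ZMod (p ^ 1)) ∧
        (a.a₂ : ZMod (p ^ 1)) = (a₀.a₂ : ZMod (p ^ 1)) ∧
        (a.a₂' : ZMod (p ^ 1)) = (a₀.a₂' : ZMod (p ^ 1)) ∧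
        (a.a₃ : ZMod (p ^ 1)) = (a₀.a₃ : ZMod (p ^ 1)) := by
      intro p hp
      have h := ha.2 p hp
      simp only [Ψ, CongruenceFamily₂.residueOf, Set.mem_singleton_iff, Prod.mk.injEq] at h
      exact h
    obtain ⟨b₁, b₂, b₂', b₃⟩ := a
    obtain ⟨c₁, c₂, c₂', c₃⟩ := a₀
    simp only [Params.mk.injEq]
    exact ⟨(eq_of_forall_prime_dvd_sub fun p hp ↦ dvd_sub_of_intCast_zmod_pow_one_eq (key p hp).1).symm,
      (eq_of_forall_prime_dvd_sub fun p hp ↦ dvd_sub_of_intCast_zmod_pow_one_eq (key p hp).2.1).symm,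
      (eq_of_forall_prime_dvd_sub fun p hp ↦
        dvd_sub_of_intCast_zmod_pow_one_eq (key p hp).2.2.1).symm,
      (eq_of_forall_prime_dvd_sub fun p hp ↦
        dvd_sub_of_intCast_zmod_pow_one_eq (key p hp).2.2.2).symm⟩
  · subst ha
    exact ⟨h₀, fun p _ ↦ by simp [Ψ, CongruenceFamily₂.residueOf]⟩

/-- **I2 is false without `IsLarge`** (modulo Modularity, used only to certify one root number): it is
NOT true that every subfamily of `F₂` with a nonempty congruence condition at every prime has root
number `+1` with lower density `> 1/6` — the point family of `a⁻ = (0, 0, 1, 1)` (37a1) has the single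
member `a⁻`, of root number `−1`, so the proportion of root number `+1` is identically `0`. So the
hypothesis `Φ.IsLarge` of `RootNumberPlusLowerDensityLargeF2` is load-bearing: every proof of I2 must
use largeness beyond the nonemptiness of the height balls.
[cite: Cremona1997, Table 1 (curve 37a1: sign −1); BhargavaHo2022, §1 (large subfamilies)] -/
theorem rootNumberPlusLowerDensity_false_without_isLarge (hmod : ModularForms.exists_isNewformOf) :
    ¬ ∀ Φ : CongruenceFamily₂, (∀ p : ℕ, p.Prime → (Φ.residues p).Nonempty) →
        ∃ ρ : ℝ, 1 / 6 < ρ ∧ Φ.DensityOnGE (fun a ↦ a.curve.rootNumber = 1) ρ := by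
  intro h
  obtain ⟨Ψ, hne, hmem⟩ := exists_pointFamily ⟨0, 0, 1, 1⟩ isMember_p37
  obtain ⟨ρ, hρ, hD⟩ := h Ψ hne
  refine not_densityOnGE_of_forall_mem_not Ψ (fun a ha hw ↦ ?_) (by linarith) hD
  rw [(hmem a).1 ha, rootNumber_curve_p37 hmod] at hw
  norm_num at hw

/-! ### §4 Weighted scalings: infinitely many members of each root number -/

/-- **The weighted scaling `t • a = (t a₁, t² a₂, t² a₂', t³ a₃)` is the variable change `u = t⁻¹`**
(`r = s = t = 0`) of `E_a`: `[t a₁, 0, t³ a₃, t⁴ a₄, t⁶ a₆]`. [cite: SilvermanAEC2009, III.1 Table 3.1 (u-scaling of a Weierstrass equation)] -/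
theorem curve_scale_eq_smul (a : Params) (t : ℤ) (ht : t ≠ 0) :
    (⟨t * a.a₁, t ^ 2 * a.a₂, t ^ 2 * a.a₂', t ^ 3 * a.a₃⟩ : Params).curve =
      (⟨(Units.mk0 (t : ℚ) (by exact_mod_cast ht))⁻¹, 0, 0, 0⟩ : VariableChange ℚ) • a.curve := by
  rw [WeierstrassCurve.variableChange_def, Params.curve_eq, Params.curve_eq]
  ext <;> simp <;> ring

/-- `Δ(t • a) = t¹² Δ(a)` (the discriminant polynomial of `F₂` is weighted-homogeneous of weight `12`).
[cite: BhargavaHo2022, §1 (the discriminant polynomial Δ)] -/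
theorem curveInt_Δ_scale (a : Params) (t : ℤ) :
    (⟨t * a.a₁, t ^ 2 * a.a₂, t ^ 2 * a.a₂', t ^ 3 * a.a₃⟩ : Params).curveInt.Δ =
      t ^ 12 * a.curveInt.Δ := by
  simp only [Params.curveInt, WeierstrassCurve.Δ, WeierstrassCurve.b₂, WeierstrassCurve.b₄,
    WeierstrassCurve.b₆, WeierstrassCurve.b₈]
  ring

/-- Membership is preserved by weighted scaling with `t ≠ 0` (`Δ(t • a) = t¹² Δ(a) ≠ 0`).
[cite: BhargavaHo2022, §1 (definition of F₂)] -/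
theorem isMember_scale (a : Params) (ha : a.IsMember) (t : ℤ) (ht : t ≠ 0) :
    (⟨t * a.a₁, t ^ 2 * a.a₂, t ^ 2 * a.a₂', t ^ 3 * a.a₃⟩ : Params).IsMember := by
  rw [Params.IsMember, curveInt_Δ_scale]
  exact mul_ne_zero (pow_ne_zero 12 ht) ha

/-- **The root number is preserved by weighted scaling** (isomorphic curves: the tree's PROVED
`rootNumber_smul_holds`). [cite: SilvermanAEC2009, App. C §16 Thm. 16.3 (isomorphism invariance of L(E,s))] -/
theorem rootNumber_curve_scale (a : Params) (ha : a.IsMember) (t : ℤ) (ht : t ≠ 0) :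
    (⟨t * a.a₁, t ^ 2 * a.a₂, t ^ 2 * a.a₂', t ^ 3 * a.a₃⟩ : Params).curve.rootNumber =
      a.curve.rootNumber := by
  haveI : a.curve.IsElliptic := a.isElliptic_curve ha
  rw [curve_scale_eq_smul a t ht]
  exact rootNumber_smul_holds a.curve _

/-- The scalings `t • a⁰`, `t = 1, 2, 3, …`, of a parameter with `a₃ ≠ 0` are pairwise distinct
(`t³ a₃` determines `t`). [folklore] -/
theorem scale_injective (a : Params) (h3 : a.a₃ ≠ 0) :
    Function.Injective fun n : ℕ ↦
      (⟨(n + 1 : ℤ) * a.a₁, (n + 1 : ℤ) ^ 2 * a.a₂, (n + 1 : ℤ) ^ 2 * a.a₂',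
        (n + 1 : ℤ) ^ 3 * a.a₃⟩ : Params) := by
  intro m n hmn
  simp only [Params.mk.injEq] at hmn
  have h := mul_right_cancel₀ h3 hmn.2.2.2
  have hm : (0 : ℤ) ≤ m + 1 := by positivity
  have hn : (0 : ℤ) ≤ n + 1 := by positivity
  have := (pow_left_inj₀ hm hn (by norm_num : (3 : ℕ) ≠ 0)).mp h
  omega

/-- **`F₂` has infinitely many members of root number `−1`** (modulo Modularity, used only for the sign
of 37a1): the weighted scalings `t • (0, 0, 1, 1)`, `t ≥ 1` — pairwise distinct parameters, all
`ℚ`-isomorphic to `y² + y = x³ − x` (honest scope: one isomorphism class; not a density statement).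
[cite: Cremona1997, Table 1 (curve 37a1: sign −1); SilvermanAEC2009, App. C §16 Thm. 16.3] -/
theorem infinite_isMember_rootNumber_eq_neg_one (hmod : ModularForms.exists_isNewformOf) :
    {a : Params | a.IsMember ∧ a.curve.rootNumber = -1}.Infinite := by
  refine Set.infinite_of_injective_forall_mem (scale_injective ⟨0, 0, 1, 1⟩ (by norm_num)) fun n ↦ ?_
  have hn : ((n : ℤ) + 1) ≠ 0 := by positivity
  exact ⟨isMember_scale ⟨0, 0, 1, 1⟩ isMember_p37 _ hn,
    (rootNumber_curve_scale ⟨0, 0, 1, 1⟩ isMember_p37 _ hn).trans (rootNumber_curve_p37 hmod)⟩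

/-- **`F₂` has infinitely many members of root number `+1`** (modulo Modularity, used only for the sign
of the conductor-19 member): the weighted scalings `t • (2, 0, 0, 1)`, `t ≥ 1`.
[cite: Cremona1997, Table 1 (curve 19a: sign +1); SilvermanAEC2009, App. C §16 Thm. 16.3] -/
theorem infinite_isMember_rootNumber_eq_one (hmod : ModularForms.exists_isNewformOf) :
    {a : Params | a.IsMember ∧ a.curve.rootNumber = 1}.Infinite := by
  refine Set.infinite_of_injective_forall_mem (scale_injective ⟨2, 0, 0, 1⟩ (by norm_num)) fun n ↦ ?_
  have hn : ((n : ℤ) + 1) ≠ 0 := by positivity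
  exact ⟨isMember_scale ⟨2, 0, 0, 1⟩ isMember_p19 _ hn,
    (rootNumber_curve_scale ⟨2, 0, 0, 1⟩ isMember_p19 _ hn).trans (rootNumber_curve_p19 hmod)⟩

end Summit.BirchSwinnertonDyer.BirchSwinnertonDyer.Theorems.F2RootNumber

end
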